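import Literature.NumberTheory.LFunctions.BurnolCoPoissonEvaluatorOrthogonality
import Literature.NumberTheory.LFunctions.RHWave0HardyProofs
import HarnessLib

/-!
# Burnol 2004b, Thm. 6.7 via Lemma 7.4: for `a < 1` the evaluators `Z^a_{ρ,k}` are minimal in `K_a`

LINE 1 — LABEL: RH-FREE (Hilbert-space bookkeeping in de Branges' Sonine spaces `K_a`: the two
`ε`-chosen evaluator systems of the tree — `burnolZ` of §2 and `sonineZ` of §7 — coincide at the
non-trivial zeros of `ζ` WHEREVER those lie, and Lemma 7.4 ("not complete ⇒ minimal") is transported to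
the `ζ`-system). FRAMING (cell rh-crit, D-0074): corpus theorems are RH-FREE literature; nothing here is
worded as progress toward RH. bears_on: B-C/B-P (LADDER-RH COLUMN 6, de Branges framework). WHAT THIS
IS NOT: not a route, not a criterion, no positivity at `E_ζ` (Conrey–Li guard); minimality of an evaluator
system moves RH by nothing. Nothing here bears on the truth of RH.

Source: J.-F. Burnol, *Two complete and minimal systems associated with the zeros of the Riemann zeta
function*, JTNB 16 (2004) = arXiv:math/0203120v7 [Burnol2004b] (TeX of record
`dbl/src/Burnol2004JTNB_arXivmath0203120v7.tex`), Thm. 6.7 (TeX l.1340–1343) "Let `a < 1`. The vectors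
`Z^a_{ρ,k}` are minimal in `K_a`", whose printed proof treats a simple zero and defers the general case:
"The proof is easily extended to the case of a multiple zero (we don't do this here, as the next section
contains a proof of a more general statement)" (TeX l.1372–1375) — that statement is **Lemma 7.4**
(TeX l.1435–1438): "If the system of evaluators associated in a given `K_a` to a (non-empty) multiset `𝒵`
is not complete, then it is minimal", applied to the multiset of non-trivial zeros, which is not complete
in `K_a` for `a < 1` (Thm. 3.2 / the co-Poisson subspace `W'_a`, tree theorem
`not_isCompleteSystemIn_sonineK_burnolZSystem` of `BurnolCoPoissonEvaluatorOrthogonality.lean`).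

## What is proved (theorems only; no definition, no named fact)

* §A (bridge, `K_a`, admissible `w ≠ 1`, `Γ_ℝ(w) ≠ 0`): the ENTIRE completed transform `𝒢_f` of §7
  (`completedMellinEntire`, Thm. 2.1) and the product `Γ_ℝ·G_f` of §2 (`completedMellin`) agree near `w`
  (`BurnolZetaEvaluators.completedMellinEntire_eventuallyEq_completedMellin`); hence
  `IsSonineZ a w k Z ↔ IsBurnolZ a w k Z` and `sonineZ a w k = burnolZ a w k` at every admissible `w` — in
  particular at every non-trivial zero (`BurnolZetaEvaluators.sonineZ_eq_burnolZ`).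
* §B (bookkeeping): completeness / minimality of a system are invariant under re-indexing along an
  `Equiv`; the §7 multiset of `ζ` — written inline as
  `riemannZetaNontrivialZeros.indicator (fun w ↦ (riemannZetaZeroOrder w).toNat)` — is non-zero (Hardy:
  `Hardy.riemannZeta_zeros_on_critical_line_infinite`) with countable support, and its §7 evaluator
  system IS the §2 system `burnolZSystem a` up to the index equivalence `MultisetIndex ≃ ZetaZeroIndex`.
* §C: **`Burnol2004b_thm6_7_of_lemma7_4 : Burnol2004b_lemma7_4 → Burnol2004b_thm6_7`** (the §7 road
  of the printed text) and `Burnol2004b_thm3_2_of_lemma7_4 : Burnol2004b_lemma7_4 → Burnol2004b_prop6_5 →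
  Burnol2004b_prop6_6 → Burnol2004b_thm3_2`. (The unconditional discharge `Burnol2004b_thm6_7_holds`
  by Burnol's own §6 argument — explicit dual vectors `g_ρ` — is a separate module of the cell; this
  file declares no `_holds`.)

## References
* [Burnol2004b] Thm. 6.7 (arXiv:math/0203120v7 p. 17, TeX l.1340–1375), Lemma 7.4 (p. 18,
  TeX l.1435–1459), §7 opening (p. 17, TeX l.1382–1398), Thm. 2.1 (p. 5, TeX l.437–443), §2 (p. 5,
  TeX l.472–491).
* [Hardy1914] G. H. Hardy, C. R. Acad. Sci. Paris 158 (1914) 1012–1014 (tree `RHWave0HardyProofs.lean`).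
-/

noncomputable section

open MeasureTheory Complex Filter Set
open scoped Topology

namespace Literature.NumberTheory.LFunctions

namespace BurnolZetaEvaluators

/-! ## A. The two completed transforms agree off `s = 1` and the poles of `Γ_ℝ`; `sonineZ = burnolZ` -/

/-- `Γ_ℝ` is differentiable away from its poles (where Mathlib's `Γ_ℝ` takes the junk value `0`). [folklore] -/
private theorem differentiableAt_Gammaℝ {z : ℂ} (hz : Gammaℝ z ≠ 0) : DifferentiableAt ℂ Gammaℝ z := by
  have h : ∀ m : ℕ, z / 2 ≠ -m := by
    intro m hm
    apply hz
    rw [Gammaℝ_eq_zero_iff]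
    exact ⟨m, by linear_combination 2 * hm⟩
  have h1 : DifferentiableAt ℂ (fun s : ℂ ↦ (Real.pi : ℂ) ^ (-s / 2)) z :=
    ((differentiableAt_id.neg.div_const 2).const_cpow (Or.inl (ofReal_ne_zero.2 Real.pi_pos.ne')))
  have h2 : DifferentiableAt ℂ (fun s : ℂ ↦ Complex.Gamma (s / 2)) z :=
    (Complex.differentiableAt_Gamma _ h).comp z (differentiableAt_id.div_const 2)
  have e : Gammaℝ = fun s ↦ (Real.pi : ℂ) ^ (-s / 2) * Complex.Gamma (s / 2) := funext Gammaℝ_def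
  rw [e]
  exact h1.mul h2

/-- `Γ_ℝ(w) ≠ 0` for `w ∉ {0, −2, −4, …}`. [folklore] -/
private theorem Gammaℝ_ne_zero_of_ne {w : ℂ} (hw0 : w ≠ 0)
    (hwn : ∀ n : ℕ, w ≠ -2 * ((n : ℂ) + 1)) : Gammaℝ w ≠ 0 := by
  intro h
  obtain ⟨n, hn⟩ := Gammaℝ_eq_zero_iff.1 h
  cases n with
  | zero => exact hw0 (by simpa using hn)
  | succ m => exact hwn m (by rw [hn]; push_cast; ring)

/-- The set `ℂ ∖ ({1} ∪ {poles of Γ_ℝ})` is open and preconnected (complement of a countable set in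
`ℂ ≅ ℝ²`). [folklore] -/
private theorem isOpen_isPreconnected_admissible :
    IsOpen {s : ℂ | s ≠ 1 ∧ (Gammaℝ s)⁻¹ ≠ 0} ∧ IsPreconnected {s : ℂ | s ≠ 1 ∧ (Gammaℝ s)⁻¹ ≠ 0} := by
  refine ⟨isOpen_ne.inter (isOpen_ne_fun differentiable_Gammaℝ_inv.continuous continuous_const), ?_⟩
  have hS : (({1} : Set ℂ) ∪ {s : ℂ | Gammaℝ s = 0}).Countable := by
    refine (Set.countable_singleton 1).union ?_
    refine (Set.countable_range (fun n : ℕ ↦ (-(2 * (n : ℂ)) : ℂ))).mono ?_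
    intro s hs
    obtain ⟨n, hn⟩ := Gammaℝ_eq_zero_iff.1 hs
    exact ⟨n, hn.symm⟩
  have h := (hS.isConnected_compl_of_one_lt_rank (by simp)).isPreconnected
  have hc : (({1} : Set ℂ) ∪ {s : ℂ | Gammaℝ s = 0})ᶜ = {s : ℂ | s ≠ 1 ∧ (Gammaℝ s)⁻¹ ≠ 0} := by
    ext s
    simp [inv_eq_zero]
  rwa [hc] at h

/-- **The §7 transform `𝒢_f` and the §2 transform `Γ_ℝ·G_f` agree near every admissible point** (`f ∈ K_a`,
`w ≠ 1`, `Γ_ℝ(w) ≠ 0`): both are holomorphic on the connected open set `ℂ ∖ ({1} ∪ −2ℕ)` and agree on the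
strip `1/2 < Re s < 1`, where each is `Γ_ℝ(s)f̂(s)` (Thm. 2.1 / Prop. 2.2).
[cite: Burnol2004b, Thm. 2.1 and Prop. 2.2 (arXiv:math/0203120v7 p. 5, TeX l.437–469)] -/
theorem completedMellinEntire_eventuallyEq_completedMellin {a : ℝ} (ha : 0 < a)
    {f : Lp ℂ 2 (volume : Measure ℝ)} (hf : f ∈ sonineK a) {w : ℂ} (hw1 : w ≠ 1) (hΓ : Gammaℝ w ≠ 0) :
    completedMellinEntire (f : ℝ → ℂ) =ᶠ[𝓝 w] completedMellin (f : ℝ → ℂ) := by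
  obtain ⟨hMd, hMeq⟩ := hasCompletedMellinEntire_of_mem_sonineK ha hf
  obtain ⟨hGd, hGeq⟩ :=
    hasRightMellinContinuation_rightMellinExt_of_mem_sonineL ha (sonineK_subset_sonineL a hf)
  obtain ⟨hVo, hVc⟩ := isOpen_isPreconnected_admissible
  set V : Set ℂ := {s : ℂ | s ≠ 1 ∧ (Gammaℝ s)⁻¹ ≠ 0} with hV
  have h1 : AnalyticOnNhd ℂ (completedMellinEntire (f : ℝ → ℂ)) V :=
    hMd.differentiableOn.analyticOnNhd hVo
  have h2 : AnalyticOnNhd ℂ (completedMellin (f : ℝ → ℂ)) V := by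
    refine DifferentiableOn.analyticOnNhd (fun z hz ↦ ?_) hVo
    have hz' : Gammaℝ z ≠ 0 := fun h0 ↦ hz.2 (by rw [h0, inv_zero])
    have hGz : DifferentiableAt ℂ (rightMellinExt (f : ℝ → ℂ)) z :=
      (hGd z hz.1).differentiableAt (isOpen_ne.mem_nhds hz.1)
    exact ((differentiableAt_Gammaℝ hz').mul hGz).differentiableWithinAt
  have h34 : (3 / 4 : ℂ) ∈ V := by
    refine ⟨?_, inv_ne_zero (Gammaℝ_ne_zero_of_re_pos (by norm_num))⟩
    intro h
    have := congrArg Complex.re h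
    norm_num at this
  have hstrip : IsOpen {z : ℂ | 1 / 2 < z.re ∧ z.re < 1} :=
    (isOpen_lt continuous_const Complex.continuous_re).inter
      (isOpen_lt Complex.continuous_re continuous_const)
  have hev : completedMellinEntire (f : ℝ → ℂ) =ᶠ[𝓝 (3 / 4 : ℂ)] completedMellin (f : ℝ → ℂ) := by
    filter_upwards [hstrip.mem_nhds (show (3 / 4 : ℂ) ∈ {z : ℂ | 1 / 2 < z.re ∧ z.re < 1} by
      simp only [Set.mem_setOf_eq]; norm_num)] with z hz
    unfold completedMellin
    rw [hMeq z hz.1 hz.2, hGeq z hz.1 hz.2]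
  have heq := h1.eqOn_of_preconnected_of_eventuallyEq h2 hVc h34 hev
  exact heq.eventuallyEq_of_mem (hVo.mem_nhds ⟨hw1, inv_ne_zero hΓ⟩)

/-- **At an admissible point the §7 and §2 evaluator relations coincide**: for `w ≠ 1`, `Γ_ℝ(w) ≠ 0`,
`Z` represents `f ↦ 𝒢_f^{(k)}(w)` on `K_a` iff it represents `f ↦ (Γ_ℝ·G_f)^{(k)}(w) = M(f)^{(k)}(w)`.
[cite: Burnol2004b, §2 and §7 (arXiv:math/0203120v7 pp. 5, 17; TeX l.481–484, 1382–1389)] -/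
theorem isSonineZ_iff_isBurnolZ {a : ℝ} (ha : 0 < a) {w : ℂ} (hw1 : w ≠ 1) (hΓ : Gammaℝ w ≠ 0)
    (k : ℕ) (Z : Lp ℂ 2 (volume : Measure ℝ)) : IsSonineZ a w k Z ↔ IsBurnolZ a w k Z := by
  constructor
  · rintro ⟨hZ, h⟩
    refine ⟨hZ, fun f hf ↦ ?_⟩
    rw [h f hf, burnolEval,
      (completedMellinEntire_eventuallyEq_completedMellin ha hf hw1 hΓ).iteratedDeriv_eq]
  · rintro ⟨hZ, h⟩
    refine ⟨hZ, fun f hf ↦ ?_⟩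
    rw [h f hf, burnolEval,
      (completedMellinEntire_eventuallyEq_completedMellin ha hf hw1 hΓ).iteratedDeriv_eq]

/-- At an admissible point (`w ≠ 0, 1`, `w ≠ −2(n+1)`) the `ε`-chosen §7 evaluator `sonineZ a w k` HAS
its defining property (existence via the §2 evaluator `burnolZ a w k` of
`BurnolEvaluators.isBurnolZ_burnolZ`). [cite: Burnol2004b, §7 (arXiv:math/0203120v7 p. 17, TeX l.1382–1389)] -/
private theorem isSonineZ_sonineZ_of_ne {a : ℝ} (ha : 0 < a) {w : ℂ} (hw0 : w ≠ 0) (hw1 : w ≠ 1)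
    (hwn : ∀ n : ℕ, w ≠ -2 * ((n : ℂ) + 1)) (k : ℕ) : IsSonineZ a w k (sonineZ a w k) := by
  have hΓ := Gammaℝ_ne_zero_of_ne hw0 hwn
  have hB := BurnolEvaluators.isBurnolZ_burnolZ ha hw0 hw1 hwn k
  have hS : IsSonineZ a w k (burnolZ a w k) := (isSonineZ_iff_isBurnolZ ha hw1 hΓ k _).2 hB
  exact Classical.epsilon_spec (p := fun Z ↦ IsSonineZ a w k Z) ⟨_, hS⟩

/-- **`sonineZ a w k = burnolZ a w k` at every admissible point** — the two `ε`-chosen evaluators of the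
tree are the same vector (uniqueness of the representing vector, `IsBurnolZ.unique`).
[cite: Burnol2004b, §2 and §7 (arXiv:math/0203120v7 pp. 5, 17; TeX l.481–484, 1382–1389)] -/
theorem sonineZ_eq_burnolZ {a : ℝ} (ha : 0 < a) {w : ℂ} (hw0 : w ≠ 0) (hw1 : w ≠ 1)
    (hwn : ∀ n : ℕ, w ≠ -2 * ((n : ℂ) + 1)) (k : ℕ) : sonineZ a w k = burnolZ a w k := by
  have hΓ := Gammaℝ_ne_zero_of_ne hw0 hwn
  have hS := isSonineZ_sonineZ_of_ne ha hw0 hw1 hwn k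
  exact ((isSonineZ_iff_isBurnolZ ha hw1 hΓ k _).1 hS).unique
    (BurnolEvaluators.isBurnolZ_burnolZ ha hw0 hw1 hwn k)

/-- A non-trivial zero is an admissible point: `ρ ≠ 0, 1` and `ρ ≠ −2(n+1)` (`ζ(0) = −1/2`, `ζ(1) ≠ 0`,
trivial zeros excluded by definition). [folklore] -/
private theorem admissible {ρ : ℂ} (hρ : ρ ∈ ZetaZeros.riemannZetaNontrivialZeros) :
    ρ ≠ 0 ∧ ρ ≠ 1 ∧ ∀ n : ℕ, ρ ≠ -2 * ((n : ℂ) + 1) := by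
  have hζ : riemannZeta ρ = 0 := hρ.1
  refine ⟨?_, fun h ↦ riemannZeta_one_ne_zero (h ▸ hζ), fun n hn ↦ hρ.2 ⟨n, by rw [hn]⟩⟩
  rintro rfl
  rw [riemannZeta_zero] at hζ
  norm_num at hζ

/-! ## B. Re-indexing of systems; the §7 multiset of `ζ` and its evaluator system -/

section Reindex

variable {ι ι' E : Type*} [AddCommGroup E] [Module ℂ E] [TopologicalSpace E]

/-- Completeness of a system in `S` is invariant under re-indexing along a bijection.
[cite: Burnol2004b, §3 (arXiv:math/0203120v7 p. 6, TeX l.551–555), "an indexed collection of vectors"] -/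
theorem isCompleteSystemIn_comp_equiv {S : Set E} {u : ι → E} (e : ι' ≃ ι) :
    IsCompleteSystemIn S (u ∘ e) ↔ IsCompleteSystemIn S u := by
  unfold IsCompleteSystemIn
  rw [e.surjective.range_comp]
  constructor
  · rintro ⟨h1, h2⟩
    exact ⟨fun i ↦ by simpa using h1 (e.symm i), h2⟩
  · rintro ⟨h1, h2⟩
    exact ⟨fun i ↦ h1 (e i), h2⟩

/-- Minimality of a system is invariant under re-indexing along a bijection.
[cite: Burnol2004b, §3 (arXiv:math/0203120v7 p. 6, TeX l.551–555), "no `u_α` is in the closure of the linear span of the `u_β`'s, `β ≠ α`"] -/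
theorem isMinimalSystem_comp_equiv {u : ι → E} (e : ι' ≃ ι) :
    IsMinimalSystem (u ∘ e) ↔ IsMinimalSystem u := by
  have himg : ∀ i' : ι', (u ∘ e) '' {j' : ι' | j' ≠ i'} = u '' {j : ι | j ≠ e i'} := by
    intro i'
    rw [Set.image_comp]
    congr 1
    ext j
    simp only [Set.mem_image, Set.mem_setOf_eq]
    constructor
    · rintro ⟨j', hj', rfl⟩
      exact fun h ↦ hj' (e.injective h)
    · intro hj
      exact ⟨e.symm j, fun h ↦ hj (by rw [← h, e.apply_symm_apply]), e.apply_symm_apply j⟩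
  unfold IsMinimalSystem
  constructor
  · intro h i
    have := h (e.symm i)
    rw [himg, e.apply_symm_apply] at this
    simpa using this
  · intro h i'
    rw [himg]
    exact h (e i')

end Reindex

/-- The indices of the §7 system of the `ζ`-multiset are exactly the indices `(ρ,k)`, `0 ≤ k < m_ρ`, of
the §2 system. [cite: Burnol2004b, §2 Definition and §7 (arXiv:math/0203120v7 pp. 5, 17; TeX l.486–491, 1382–1389)] -/
theorem lt_zetaMultiset_iff (w : ℂ) (k : ℕ) :
    k < ZetaZeros.riemannZetaNontrivialZeros.indicator (fun w ↦ (riemannZetaZeroOrder w).toNat) w ↔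
      w ∈ ZetaZeros.riemannZetaNontrivialZeros ∧ (k : ℤ) < riemannZetaZeroOrder w := by
  by_cases hw : w ∈ ZetaZeros.riemannZetaNontrivialZeros
  · rw [Set.indicator_of_mem hw]
    simp only [hw, true_and]
    exact Int.lt_toNat
  · rw [Set.indicator_of_notMem hw]
    simp [hw]

/-- **The §7 evaluator system of the `ζ`-multiset IS the §2 system `(Z^a_{ρ,k})`** up to re-indexing:
`sonineZSystem a 𝒵_ζ = burnolZSystem a ∘ e` with `e : MultisetIndex 𝒵_ζ ≃ ZetaZeroIndex` the identity
on `(ρ, k)`. [cite: Burnol2004b, §2 Definition and §7 (arXiv:math/0203120v7 pp. 5, 17; TeX l.486–491, 1382–1389)] -/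
theorem sonineZSystem_zetaMultiset_eq {a : ℝ} (ha : 0 < a) :
    ∃ e : MultisetIndex (ZetaZeros.riemannZetaNontrivialZeros.indicator
        fun w ↦ (riemannZetaZeroOrder w).toNat) ≃ ZetaZeroIndex,
      sonineZSystem a (ZetaZeros.riemannZetaNontrivialZeros.indicator
          fun w ↦ (riemannZetaZeroOrder w).toNat) = burnolZSystem a ∘ e := by
  refine ⟨Equiv.subtypeEquivRight fun p : ℂ × ℕ ↦ lt_zetaMultiset_iff p.1 p.2, ?_⟩
  funext p
  have hp : p.1.1 ∈ ZetaZeros.riemannZetaNontrivialZeros := ((lt_zetaMultiset_iff p.1.1 p.1.2).1 p.2).1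
  obtain ⟨h0, h1, hn⟩ := admissible hp
  show sonineZ a p.1.1 p.1.2 = burnolZ a p.1.1 p.1.2
  exact sonineZ_eq_burnolZ ha h0 h1 hn p.1.2

/-- The `ζ`-multiset is non-zero: `ζ` HAS a non-trivial zero (Hardy: infinitely many on the critical
line). [cite: Hardy1914, C. R. Acad. Sci. Paris 158 (1914), 1012–1014] -/
theorem zetaMultiset_ne_zero :
    (ZetaZeros.riemannZetaNontrivialZeros.indicator fun w ↦ (riemannZetaZeroOrder w).toNat) ≠ 0 := by
  obtain ⟨t, ht⟩ := Hardy.riemannZeta_zeros_on_critical_line_infinite.nonempty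
  have hζ : riemannZeta (1 / 2 + t * I) = 0 := ht
  have hmem : (1 / 2 + t * I : ℂ) ∈ ZetaZeros.riemannZetaNontrivialZeros := by
    refine ⟨hζ, ?_⟩
    rintro ⟨n, hn⟩
    have := congrArg Complex.re hn
    simp at this
    linarith [n.cast_nonneg (α := ℝ)]
  have hρ1 : (1 / 2 + t * I : ℂ) ≠ 1 := fun h ↦ riemannZeta_one_ne_zero (h ▸ hζ)
  have hord : 0 < riemannZetaZeroOrder (1 / 2 + t * I) := (riemannZetaZeroOrder_pos_iff hρ1).2 hζ
  intro h
  have h0 := congrFun h (1 / 2 + t * I)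
  rw [Set.indicator_of_mem hmem, Pi.zero_apply] at h0
  omega

/-- The `ζ`-multiset has countable support (the zero set of `ζ` is closed and discrete, hence meets
every compact set in a finite set) — the standing hypothesis "(non-empty) multiset `𝒵`" of §7, i.e. a
countable multiset of complex numbers. [cite: Burnol2004b, §7 (arXiv:math/0203120v7 p. 17, TeX l.1382–1389)] -/
theorem countable_support_zetaMultiset :
    (Function.support (ZetaZeros.riemannZetaNontrivialZeros.indicator
      fun w ↦ (riemannZetaZeroOrder w).toNat)).Countable := by
  have hZ : riemannZetaZeros.Countable := by
    have hcov : riemannZetaZeros ⊆ ⋃ n : ℕ, (Metric.closedBall (0 : ℂ) n ∩ riemannZetaZeros) := by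
      intro z hz
      obtain ⟨n, hn⟩ := exists_nat_ge ‖z‖
      exact Set.mem_iUnion.2 ⟨n, ⟨by simpa using hn, hz⟩⟩
    refine (Set.countable_iUnion fun n ↦ ?_).mono hcov
    exact ((isCompact_closedBall (0 : ℂ) n).inter_riemannZetaZeros_finite).countable
  refine hZ.mono ?_
  intro w hw
  have hw' : w ∈ ZetaZeros.riemannZetaNontrivialZeros := by
    by_contra h
    exact hw (Set.indicator_of_notMem h _)
  exact hw'.1

/-! ## C. Thm. 6.7 from Lemma 7.4; Thm. 3.2 from Lemma 7.4 and Props. 6.5, 6.6 -/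

/-- For `0 < a < 1` the §7 evaluator system of the `ζ`-multiset is not complete in `K_a` (transport of
`not_isCompleteSystemIn_sonineK_burnolZSystem`, the co-Poisson subspace `W'_a`).
[cite: Burnol2004b, Thm. 3.2 (arXiv:math/0203120v7 p. 6, TeX l.528–530) and §7 opening (p. 17, TeX l.1398–1407), "`= 1` for the zeros of `ζ`"] -/
theorem not_isCompleteSystemIn_sonineZSystem_zetaMultiset {a : ℝ} (ha : 0 < a) (ha1 : a < 1) :
    ¬ IsCompleteSystemIn (sonineK a)
      (sonineZSystem a (ZetaZeros.riemannZetaNontrivialZeros.indicator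
        fun w ↦ (riemannZetaZeroOrder w).toNat)) := by
  obtain ⟨e, he⟩ := sonineZSystem_zetaMultiset_eq ha
  rw [he, isCompleteSystemIn_comp_equiv]
  exact not_isCompleteSystemIn_sonineK_burnolZSystem ha ha1

end BurnolZetaEvaluators

open BurnolZetaEvaluators in
/-- **Thm. 6.7 from Lemma 7.4.** "Let `a < 1`. The vectors `Z^a_{ρ,k}` are minimal in `K_a`" — by
Lemma 7.4 ("not complete ⇒ minimal") for the multiset of non-trivial zeros, whose evaluator system is not
complete in `K_a` for `a < 1` (the co-Poisson Sonine vector of `W'_a`), the §7 system being the §2 system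
`(Z^a_{ρ,k})` re-indexed. This is the printed road for a multiple zero: "the next section contains a
proof of a more general statement". [cite: Burnol2004b, Thm. 6.7 (arXiv:math/0203120v7 p. 17, TeX l.1340–1375) and Lemma 7.4 (p. 18, TeX l.1435–1459)] -/
theorem Burnol2004b_thm6_7_of_lemma7_4 (h74 : Burnol2004b_lemma7_4) : Burnol2004b_thm6_7 := by
  intro a ha ha1
  have hmin := h74 _ zetaMultiset_ne_zero countable_support_zetaMultiset a ha
    (not_isCompleteSystemIn_sonineZSystem_zetaMultiset ha ha1)
  obtain ⟨e, he⟩ := sonineZSystem_zetaMultiset_eq ha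
  rw [he, isMinimalSystem_comp_equiv] at hmin
  exact hmin

/-- **Thm. 3.2 from Lemma 7.4 and Props. 6.5, 6.6** (the tree's assembly `Burnol2004b_thm3_2_of` with
both `a < 1` inputs — minimality via Lemma 7.4, non-completeness via `W'_a` — supplied).
[cite: Burnol2004b, §6 (arXiv:math/0203120v7 pp. 16–17, TeX l.1303–1378), "The three theorems 3.1, 3.2, 3.3 are thus established"] -/
theorem Burnol2004b_thm3_2_of_lemma7_4 (h74 : Burnol2004b_lemma7_4) (h65 : Burnol2004b_prop6_5)
    (h66 : Burnol2004b_prop6_6) : Burnol2004b_thm3_2 :=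
  Burnol2004b_thm3_2_of_constituents (Burnol2004b_thm6_7_of_lemma7_4 h74) h65 h66

end Literature.NumberTheory.LFunctions
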